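import Summits.Parity.GeneralizedHardyLittlewood.Theses.ParityLeakOneFifth

/-!
# Birth skeleton (BC3) — crux `PlainSplit` of route ParityLeakOneFifth (item stmt-Parity-18382, rank 6, L)
# line `birth`: the route's own three-line split, cut at its two analytic joints
# (model-mass asymptotics of the `z`-rough model / the calibration lower bound `Π ≫ x / log x`),
# with the split itself PROVED here.

Registered by the skeleton registrar (planner one-shot `planner-skel-stmt-Parity-18382-0`, 2026-08-17;
BC3 of `run/shared/lean/lens3/_common/BC.md`) for route `route-Parity-ParityLeakOneFifth` (rev 0;
`closes (h₁ : PintzDensity) (h₂ : CalibratedE1) (h₃ : PlainSplit) (h₄ : ParityLeakSieve)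
(h₅ : TwinLowerDensityToGHL) : GeneralizedHardyLittlewood`). It supersedes the opening seat's
registration (stubs `stub_model_mass`, `stub_calibration`, `stub_assemble`), in which the assembly
itself was a sorried stub: here the assembly `PlainSplit_of` is a complete proof and only the two
analytic inputs named in the crux's docstring ("needs Π ≥ c₀x/log x … and Σ_n b_n λ(n+2) = o(x) …
B ∼ x") remain as stubs — the decomposition the route header announces under TWO-LAYER PLAN
("PlainSplit ⇐ ModelMassAsymptotics → CalibrationLowerBound → assemble"), with the model-mass input
cut once more at its natural seam (plain count of rough numbers / Liouville against the rough model).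

## The crux (FIXED; verbatim the route decl)

With `z = exp((log log x)²)`, `V = ∏_{p<z} (1 − 1/p)`, `b_n = 1[P⁻(n) ≥ z]/V`, `a_n = Λ'(n)`,
`Φ = Φ_{ε,x}` the (W1)@1/5 type function on `m = n + 2`, and on the window `n ∈ (x, 2x]`:
`W_Φ = Σ Φ(n+2)(a_n − b_n)`, `Π = Σ b_n λ(n+2) Φ(n+2)`, `B = Σ b_n`, `W_λ = Σ λ(n+2)(a_n − b_n)`,
the crux is `PlainSplit : CalibratedE1 → PintzDensity → E1NonSaturation`, i.e.
K2 (`W_Φ − (Π/B)·W_λ ≤ θ x / log x`, every `θ > 0`) and K1 (`Σ_{x<p≤2x} log p·λ(p+2) ≤ κ x`, some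
`κ < 1`) give X (`W_Φ ≤ (1 − η) Π`, some `η > 0`, all small `ε`, large `x`).

## The cut

* `stub_roughMass` (M — fundamental lemma): `B = Σ_{x<n≤2x} b_n = (1 + o(1)) x`, i.e. the
  `z`-rough integers of `(x, 2x]` number `(1 + o(1)) x V(z)` for `z = exp((log log x)²) = x^{o(1)}`
  (`u = log x / log z → ∞`). Why plausible: the fundamental lemma of the (β-sieve or Rosser) sieve for the
  interval `(x, 2x]` (`A_d = x/d + O(1)`) at level `z^s`, `s → ∞` slowly; tree:
  `Literature.NumberTheory.Sieve.SieveFrameworkFundamentalLemma`. Why it might fail: it cannot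
  (classical), only the bookkeeping `⌈z⌉₊`/`range` conventions need care. [HalberstamRichert1974 Thm 2.5]
* `stub_roughLiouville` (M/L — FL weights + Bombieri–Vinogradov for `λ`):
  `Σ_{x<n≤2x} b_n λ(n+2) = o(x)`, i.e. `Σ_{n z-rough} λ(n+2) = o(x V)`. Why plausible: write
  `1_{(n,P(z))=1} = Σ_{d∣n} λ⁺_d − E_n` with upper FL weights of level `D = z^s` and `E_n ≥ 0`,
  `Σ_n E_n ≪ e^{−s} x V + D`; the weighted part is `Σ_{d ≤ D, d ∣ P(z)} |Σ_{m ∈ (x+2,2x+2], m ≡ 2 (d)} λ(m)|`,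
  `≪ x (log x)^{−A}` by Bombieri–Vinogradov for `λ` (even `d = 2d'`: `λ(2m') = −λ(m')`, class
  `m' ≡ 1 (d')`), and `x(log x)^{−A} = o(xV)` since `V ≍ (log log x)^{−2}`. Why it might fail: only if
  the level `D = exp(s (log log x)²)` (beyond every `(log x)^A`, so Siegel–Walfisz alone does NOT
  suffice) were mishandled — BV-for-λ covers it. [HalberstamRichert1974 Thm 2.5; IwaniecKowalski2004 Thm 17.1 (BV for μ/λ)]
* `stub_calibrationLowerBound` (L — the HARDEST; the "model computation with PNT-level inputs" of
  the crux docstring): there is `ε₁ > 0` such that for every `0 < ε ≤ ε₁` there are `c₀ = c₀(ε) > 0`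
  and `x₀` with `Π(ε, x) ≥ c₀ x / log x` for `x ≥ x₀`. Why plausible: `Π` is the parity-line value
  of the sieve's one consumed Type-II functional; by the route's zero-parity-defect computation at
  `ν = 1/5` it equals the (W1) lower-bound sieve main term `𝔠(1/5)·𝔖·x/log x·(1+o(1))`,
  `𝔠(1/5) = 1 − 2M₃(1/5) = 0.362 > 0` (FordMaynard2024 Thm 2.7 / DFI corner), evaluated by Buchstab
  iteration for `λ` on rough numbers (`Σ_{P⁻(k) ≥ w} λ(k) = −r(u) y/log y + o`, `r(u) = 1` on `(1,2]`,
  `r(u) = 1 − log(u−1)` on `[2,3]`, …) twisted by the `z`-rough model (FL + BV-λ as in stub 2).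
  `c₀` is allowed to depend on `ε` (the assembly chooses `θ` after `ε`), which is all the split needs.
  Why it might fail: a sign/size error in the claimed identification `Π ∼ main term` (the crux's own
  "fails only if the calibration lower bound were mis-evaluated"); Buchstab-range oscillations of
  `r(u)` for `u ≥ 4` make the sign a genuine computation. [Bombieri1976; arXiv:2407.14368 Thm 2.7; Harman2007 §14]

Composition `PlainSplit_of : roughMass → roughLiouville → calibrationLowerBound → PlainSplit`
(REAL proof, this file, `assembly_abstract`): put `κ₊ = max κ 0`, `s = 1 − κ₊ ∈ (0,1]`, `η = s/3`;
given `ε ≤ min ε₁ ε₂` take `c₀ = c₀(ε)`, `θ = c₀ s/3`, `δ = s/6`; for large `x`: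
`W_Φ ≤ θx/log x + (Π/B) W_λ` (K2), `W_λ = Σ_p log p λ(p+2) − Σ b_n λ(n+2) ≤ (κ₊ + δ) x` (K1, stub 2;
the identity `Wl_eq` is proved), `Π ≥ c₀ x/log x > 0` (stub 3) and `B ≥ (1 − δ) x > 0` (stub 1) give
`(Π/B)(κ₊+δ)x ≤ (κ₊ + s/3) Π` (slack `s²x/9 ≥ 0`) and `θ x/log x ≤ (s/3) Π`, so `W_Φ ≤ (1 − s/3) Π`.

**Hardest stub:** `stub_calibrationLowerBound`.

**Barriers.** SelbergParityBarrier / PrimePairParity: not engaged by this line — the two model stubs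
concern the parity-blind model `b` only (a rough-number count and `λ` against it at level `x^{o(1)}`,
inside BV), and the calibration stub is a statement about the MODEL functional `Π` (no prime-pair
lower bound, no correlation of `λ` with primes is deduced here); the parity content of the route sits
in `PintzDensity` (K1), which enters `PlainSplit` only as a hypothesis. FordMaynardMinimalTypeII /
LargeSieveLevelHalf: not engaged (no level of distribution beyond BV is claimed; `ν = 1/5` enters only
through the constant inside stub 3). LogarithmicAveraging: not engaged (natural densities throughout).

**Disproof used:** none exists for this crux (`ledger crux ls stmt-Parity-18382`: no workfiles, no
`Disproof.lean`, 2026-08-17) — no `_false_without_` obligations. Negatives index for Parity (3 entries: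
ConvMomentLevelOne, InverseSieveTuplesTupleElliott, RectangleChowla): no stub is an instance.
**Dead lines:** none recorded for this crux.

**Cheapest falsifier:** numerics of `Π(ε, x)·log x / x` for `x ≤ 10⁹`, `ε ∈ {0.05, 0.1}` (expect a
positive constant `≍ 0.36·𝔖`); a negative or vanishing value kills stub 3 (and with it the route's
threshold `(1 − η)Π`, not merely this line).

**BC3 audit (this seat, 2026-08-17):** `lean check` rc 0, `sorry` only in the three stubs
(3 warnings = 3 stubs; `PlainSplit_of` axioms `propext`, `Classical.choice`, `Quot.sound`); probes
`stub → PlainSplit` and `stub → GeneralizedHardyLittlewood` by each alternative of the BC2 battery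
(`exact?` / `simpa using h` / `simpa [PlainSplit] using h` / `aesop`, one `example` per alternative and
target; for stub 3 also `aesop (config := { enableSimp := false })` and `aesop (simp_config :=
{ maxSteps := 1000000 })`, since plain `aesop` stops inside norm-simp there) FAIL for all three stubs and
both targets — 3 × 8 (+4) erroring examples, 0 successes (files `bc/probe2_stub_*.lean` in the seat
folder, importing only the route file; verbatim outcomes in the seat's NOTES.md).

**Registered signatures.** v2 (this file): the stubs are stated `let`-free (see "Registered stub
signatures" below) so that the registrar records each statement IN FULL; v1 (commit ece3cfb5410f, same
statements as `let`-chains) was superseded because its registered signatures were cut at the first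
`let … :=`.
-/

namespace Summit.Parity.GeneralizedHardyLittlewood.Cruxes.PlainSplit.Birth

open scoped BigOperators Topology Manifold Classical MeasureTheory ProbabilityTheory Matrix InnerProductSpace ComplexConjugate ContinuousMap
open Filter Set Function TopologicalSpace MeasureTheory

/-! ### The route's objects, named

Verbatim the `let`-bound objects of `ParityLeakOneFifth.E1NonSaturation` / `CalibratedE1` (and the
sum of `PintzDensity`), with `z`, `V` written as functions of `x` and `b`, `Φ` as functions of
`(x)`, `(ε, x)`; no proposition of the route is restated — the route-decl dictionary lemmas below are
`Iff.rfl`, the stub dictionaries instantiate the quantified abbreviations with `rfl`. -/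

/-- `z = exp((log log x)²)`. -/
noncomputable def zR (x : ℕ) : ℝ := Real.exp (Real.log (Real.log (x : ℝ)) ^ 2)

/-- `V = V(z) = ∏_{p < z} (1 − 1/p)`. -/
noncomputable def VR (x : ℕ) : ℝ := ∏ p ∈ (Finset.range ⌈zR x⌉₊).filter Nat.Prime, (1 - 1 / (p : ℝ))

/-- The `z`-rough model `b_n = 1[P⁻(n) ≥ z] / V(z)`. -/
noncomputable def bR (x : ℕ) (n : ℕ) : ℝ := if ∀ p ∈ n.primeFactors, zR x ≤ (p : ℝ) then 1 / VR x else 0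

/-- The host `a_n = Λ'(n)` (log on primes). -/
noncomputable def aR (n : ℕ) : ℝ := if n.Prime then Real.log (n : ℝ) else 0

/-- The (W1)@1/5 type function `Φ_{ε,x}(m)`. -/
noncomputable def ΦR (ε : ℝ) (x : ℕ) (m : ℕ) : ℝ :=
  if (x : ℝ) ^ (ε ^ 2) ≤ (m.minFac : ℝ) ∧ (m.minFac : ℝ) < (x : ℝ) ^ ((1 : ℝ) / 5) then ∑ d ∈ (Nat.divisors m).filter (fun d : ℕ => (d : ℝ) ≤ (x : ℝ) ^ ((1 : ℝ) / 2 - 2 * ε) ∧ ∀ p ∈ d.primeFactors, (x : ℝ) ^ ((1 : ℝ) / 5) ≤ (p : ℝ)), (ArithmeticFunction.moebius d : ℝ) else 0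

/-- `W_Φ(ε, x) = Σ_{x<n≤2x} Φ(n+2)(a_n − b_n)` — the consumed Type-II functional. -/
noncomputable def WΦ (ε : ℝ) (x : ℕ) : ℝ := ∑ n ∈ Finset.Ioc x (2 * x), ΦR ε x (n + 2) * (aR n - bR x n)

/-- `Π(ε, x) = Σ_{x<n≤2x} b_n λ(n+2) Φ(n+2)` — the parity-line value. -/
noncomputable def PiL (ε : ℝ) (x : ℕ) : ℝ :=
  ∑ n ∈ Finset.Ioc x (2 * x), bR x n * (ArithmeticFunction.liouville (n + 2) : ℝ) * ΦR ε x (n + 2)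

/-- `B(x) = Σ_{x<n≤2x} b_n` — the model mass. -/
noncomputable def BR (x : ℕ) : ℝ := ∑ n ∈ Finset.Ioc x (2 * x), bR x n

/-- `W_λ(x) = Σ_{x<n≤2x} λ(n+2)(a_n − b_n)`. -/
noncomputable def Wl (x : ℕ) : ℝ := ∑ n ∈ Finset.Ioc x (2 * x), (ArithmeticFunction.liouville (n + 2) : ℝ) * (aR n - bR x n)

/-- `L(x) = Σ_{x<n≤2x} b_n λ(n+2)` — Liouville against the rough model. -/
noncomputable def LR (x : ℕ) : ℝ := ∑ n ∈ Finset.Ioc x (2 * x), bR x n * (ArithmeticFunction.liouville (n + 2) : ℝ)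

/-- `S(x) = Σ_{x<p≤2x} log p · λ(p+2)` — the Pintz sum of `PintzDensity`. -/
noncomputable def SP (x : ℕ) : ℝ := ∑ p ∈ (Finset.Ioc x (2 * x)).filter Nat.Prime, Real.log (p : ℝ) * (ArithmeticFunction.liouville (p + 2) : ℝ)

/-! ### Dictionary: the three route decls over the named objects (definitional unfolding only) -/

theorem e1NonSaturation_iff :
    Summit.Parity.GeneralizedHardyLittlewood.Theses.ParityLeakOneFifth.E1NonSaturation ↔
      (∃ η : ℝ, 0 < η ∧ ∃ ε₁ : ℝ, 0 < ε₁ ∧ ∀ ε : ℝ, 0 < ε → ε ≤ ε₁ → ∃ x₀ : ℕ, ∀ x : ℕ, x₀ ≤ x →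
        WΦ ε x ≤ (1 - η) * PiL ε x) :=
  Iff.rfl

theorem calibratedE1_iff :
    Summit.Parity.GeneralizedHardyLittlewood.Theses.ParityLeakOneFifth.CalibratedE1 ↔
      (∃ ε₁ : ℝ, 0 < ε₁ ∧ ∀ ε : ℝ, 0 < ε → ε ≤ ε₁ → ∀ θ : ℝ, 0 < θ → ∃ x₀ : ℕ, ∀ x : ℕ, x₀ ≤ x →
        WΦ ε x - PiL ε x / BR x * Wl x ≤ θ * (x : ℝ) / Real.log (x : ℝ)) :=
  Iff.rfl

theorem pintzDensity_iff :
    Summit.Parity.GeneralizedHardyLittlewood.Theses.ParityLeakOneFifth.PintzDensity ↔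
      (∃ κ : ℝ, κ < 1 ∧ ∃ x₀ : ℕ, ∀ x : ℕ, x₀ ≤ x → SP x ≤ κ * (x : ℝ)) :=
  Iff.rfl

/-! ### Registered stub signatures

Named copies of the three stub statements (`Sig.stub_<name>`, last name component = the stub's name),
so that the hypotheses of `PlainSplit_of` are the declared stubs BY NAME for the layer-invariant audit
(`#h21_check_skeleton`); each `theorem stub_<name>` below states the same text in full (def-free,
self-contained over Mathlib: a prover restates it verbatim anywhere).

FORM. The route decls bind `z, V, b, Φ` with `let … := …`; a registered stub signature is the
theorem header up to its first `:=`, so the stubs spell the same abbreviations as universally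
quantified names with their defining equations — `∀ (z V : ℝ) (b : ℕ → ℝ), z = … → V = … → b = … → P`
(equivalent to `let z := …; …; P`: instantiate with `rfl`, cf. `sig_*_iff`). A prover proves a stub
by `intro …; rintro z V b rfl rfl rfl` (resp. `… Φ rfl`) and is then facing the `let`-free statement. -/

/-- Signature of `stub_roughMass` (model mass `B = (1 + o(1)) x`). -/
def Sig.stub_roughMass : Prop :=
  ∀ δ : ℝ, 0 < δ → ∃ x₀ : ℕ, ∀ x : ℕ, x₀ ≤ x → ∀ (z V : ℝ) (b : ℕ → ℝ), z = Real.exp (Real.log (Real.log (x : ℝ)) ^ 2) → V = ∏ p ∈ (Finset.range ⌈z⌉₊).filter Nat.Prime, (1 - 1 / (p : ℝ)) → b = (fun n : ℕ => if ∀ p ∈ n.primeFactors, z ≤ (p : ℝ) then 1 / V else 0) → |(∑ n ∈ Finset.Ioc x (2 * x), b n) - (x : ℝ)| ≤ δ * (x : ℝ)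

/-- Signature of `stub_roughLiouville` (`Σ b_n λ(n+2) = o(x)`). -/
def Sig.stub_roughLiouville : Prop :=
  ∀ δ : ℝ, 0 < δ → ∃ x₀ : ℕ, ∀ x : ℕ, x₀ ≤ x → ∀ (z V : ℝ) (b : ℕ → ℝ), z = Real.exp (Real.log (Real.log (x : ℝ)) ^ 2) → V = ∏ p ∈ (Finset.range ⌈z⌉₊).filter Nat.Prime, (1 - 1 / (p : ℝ)) → b = (fun n : ℕ => if ∀ p ∈ n.primeFactors, z ≤ (p : ℝ) then 1 / V else 0) → |∑ n ∈ Finset.Ioc x (2 * x), b n * (ArithmeticFunction.liouville (n + 2) : ℝ)| ≤ δ * (x : ℝ)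

/-- Signature of `stub_calibrationLowerBound` (`Π(ε, x) ≥ c₀(ε) x / log x`). -/
def Sig.stub_calibrationLowerBound : Prop :=
  ∃ ε₁ : ℝ, 0 < ε₁ ∧ ∀ ε : ℝ, 0 < ε → ε ≤ ε₁ → ∃ c₀ : ℝ, 0 < c₀ ∧ ∃ x₀ : ℕ, ∀ x : ℕ, x₀ ≤ x → ∀ (z V : ℝ) (b Φ : ℕ → ℝ), z = Real.exp (Real.log (Real.log (x : ℝ)) ^ 2) → V = ∏ p ∈ (Finset.range ⌈z⌉₊).filter Nat.Prime, (1 - 1 / (p : ℝ)) → b = (fun n : ℕ => if ∀ p ∈ n.primeFactors, z ≤ (p : ℝ) then 1 / V else 0) → Φ = (fun m : ℕ => if (x : ℝ) ^ (ε ^ 2) ≤ (m.minFac : ℝ) ∧ (m.minFac : ℝ) < (x : ℝ) ^ ((1 : ℝ) / 5) then ∑ d ∈ (Nat.divisors m).filter (fun d : ℕ => (d : ℝ) ≤ (x : ℝ) ^ ((1 : ℝ) / 2 - 2 * ε) ∧ ∀ p ∈ d.primeFactors, (x : ℝ) ^ ((1 : ℝ) / 5) ≤ (p : ℝ)), (ArithmeticFunction.moebius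 d : ℝ) else 0) → c₀ * (x : ℝ) / Real.log (x : ℝ) ≤ ∑ n ∈ Finset.Ioc x (2 * x), b n * (ArithmeticFunction.liouville (n + 2) : ℝ) * Φ (n + 2)

theorem sig_roughMass_iff :
    Sig.stub_roughMass ↔ (∀ δ : ℝ, 0 < δ → ∃ x₀ : ℕ, ∀ x : ℕ, x₀ ≤ x → |BR x - (x : ℝ)| ≤ δ * (x : ℝ)) := by
  constructor
  · intro h δ hδ
    obtain ⟨x₀, hx₀⟩ := h δ hδ
    exact ⟨x₀, fun x hx => hx₀ x hx _ _ _ rfl rfl rfl⟩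
  · intro h δ hδ
    obtain ⟨x₀, hx₀⟩ := h δ hδ
    refine ⟨x₀, fun x hx => ?_⟩
    rintro z V b rfl rfl rfl
    exact hx₀ x hx

theorem sig_roughLiouville_iff :
    Sig.stub_roughLiouville ↔ (∀ δ : ℝ, 0 < δ → ∃ x₀ : ℕ, ∀ x : ℕ, x₀ ≤ x → |LR x| ≤ δ * (x : ℝ)) := by
  constructor
  · intro h δ hδ
    obtain ⟨x₀, hx₀⟩ := h δ hδ
    exact ⟨x₀, fun x hx => hx₀ x hx _ _ _ rfl rfl rfl⟩
  · intro h δ hδ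
    obtain ⟨x₀, hx₀⟩ := h δ hδ
    refine ⟨x₀, fun x hx => ?_⟩
    rintro z V b rfl rfl rfl
    exact hx₀ x hx

theorem sig_calibrationLowerBound_iff :
    Sig.stub_calibrationLowerBound ↔
      (∃ ε₁ : ℝ, 0 < ε₁ ∧ ∀ ε : ℝ, 0 < ε → ε ≤ ε₁ → ∃ c₀ : ℝ, 0 < c₀ ∧ ∃ x₀ : ℕ, ∀ x : ℕ, x₀ ≤ x →
        c₀ * (x : ℝ) / Real.log (x : ℝ) ≤ PiL ε x) := by
  constructor
  · rintro ⟨ε₁, hε₁, h⟩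
    refine ⟨ε₁, hε₁, fun ε hε hεle => ?_⟩
    obtain ⟨c₀, hc₀, x₀, hx₀⟩ := h ε hε hεle
    exact ⟨c₀, hc₀, x₀, fun x hx => hx₀ x hx _ _ _ _ rfl rfl rfl rfl⟩
  · rintro ⟨ε₁, hε₁, h⟩
    refine ⟨ε₁, hε₁, fun ε hε hεle => ?_⟩
    obtain ⟨c₀, hc₀, x₀, hx₀⟩ := h ε hε hεle
    refine ⟨c₀, hc₀, x₀, fun x hx => ?_⟩
    rintro z V b Φ rfl rfl rfl rfl
    exact hx₀ x hx

/-! ### The stubs -/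

/-- **Stub 1 (model mass; M).** `B = Σ_{x<n≤2x} b_n = (1 + o(1)) x`: the `z`-rough integers of
`(x, 2x]`, `z = exp((log log x)²) = x^{o(1)}`, number `(1 + o(1))·x·V(z)` — the fundamental lemma for
an interval at level `z^s`, `s → ∞`. Tree: `Literature.NumberTheory.Sieve.SieveFrameworkFundamentalLemma`.
[cite: HalberstamRichert1974, Thm 2.5] -/
theorem stub_roughMass : ∀ δ : ℝ, 0 < δ → ∃ x₀ : ℕ, ∀ x : ℕ, x₀ ≤ x → ∀ (z V : ℝ) (b : ℕ → ℝ), z = Real.exp (Real.log (Real.log (x : ℝ)) ^ 2) → V = ∏ p ∈ (Finset.range ⌈z⌉₊).filter Nat.Prime, (1 - 1 / (p : ℝ)) → b = (fun n : ℕ => if ∀ p ∈ n.primeFactors, z ≤ (p : ℝ) then 1 / V else 0) → |(∑ n ∈ Finset.Ioc x (2 * x), b n) - (x : ℝ)| ≤ δ * (x : ℝ) := by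
  sorry

/-- **Stub 2 (Liouville against the rough model; M/L).** `Σ_{x<n≤2x} b_n λ(n+2) = o(x)`, i.e.
`Σ_{n ∈ (x,2x], (n, P(z)) = 1} λ(n+2) = o(x V(z))`: upper fundamental-lemma weights of level
`D = z^s` (`1_rough = Σ_{d∣n} λ⁺_d − E_n`, `E_n ≥ 0`, `Σ E_n ≪ e^{−s} xV + D`) plus Bombieri–Vinogradov
for `λ` in the classes `m ≡ 2 (mod d)`, `d ≤ D = exp(s (log log x)²)` (beyond the Siegel–Walfisz range,
inside level `1/2`), and `x (log x)^{−A} = o(xV)`.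
[cite: HalberstamRichert1974, Thm 2.5; IwaniecKowalski2004, Thm 17.1] -/
theorem stub_roughLiouville : ∀ δ : ℝ, 0 < δ → ∃ x₀ : ℕ, ∀ x : ℕ, x₀ ≤ x → ∀ (z V : ℝ) (b : ℕ → ℝ), z = Real.exp (Real.log (Real.log (x : ℝ)) ^ 2) → V = ∏ p ∈ (Finset.range ⌈z⌉₊).filter Nat.Prime, (1 - 1 / (p : ℝ)) → b = (fun n : ℕ => if ∀ p ∈ n.primeFactors, z ≤ (p : ℝ) then 1 / V else 0) → |∑ n ∈ Finset.Ioc x (2 * x), b n * (ArithmeticFunction.liouville (n + 2) : ℝ)| ≤ δ * (x : ℝ) := by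
  sorry

/-- **Stub 3 (calibration lower bound; L — the hardest).** For all small `ε` the parity-line value
of the consumed Type-II functional is of exact order `x / log x` and POSITIVE:
`Π(ε, x) = Σ_{x<n≤2x} b_n λ(n+2) Φ_{ε,x}(n+2) ≥ c₀(ε) x / log x` for `x ≥ x₀(ε)`. The route's
zero-parity-defect computation at `ν = 1/5` identifies `Π` with the (W1) lower-bound sieve main term
`𝔠(1/5)·𝔖·x/log x·(1 + o(1))`, `𝔠(1/5) = 1 − 2M₃(1/5) = 0.362 > 0`; the evaluation is Buchstab
iteration for `λ` on rough numbers (PNT for `λ`) twisted by the `z`-rough model (FL + BV-λ). `c₀` may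
depend on `ε` (the assembly picks `θ` after `ε`). Why it might fail: a mis-evaluation of the sign/size
of `Π` (oscillation of the λ-Buchstab function for `u ≥ 4`).
[cite: Bombieri1976; FordMaynard2024 (arXiv:2407.14368), Thm 2.7; Harman2007, §14] -/
theorem stub_calibrationLowerBound : ∃ ε₁ : ℝ, 0 < ε₁ ∧ ∀ ε : ℝ, 0 < ε → ε ≤ ε₁ → ∃ c₀ : ℝ, 0 < c₀ ∧ ∃ x₀ : ℕ, ∀ x : ℕ, x₀ ≤ x → ∀ (z V : ℝ) (b Φ : ℕ → ℝ), z = Real.exp (Real.log (Real.log (x : ℝ)) ^ 2) → V = ∏ p ∈ (Finset.range ⌈z⌉₊).filter Nat.Prime, (1 - 1 / (p : ℝ)) → b = (fun n : ℕ => if ∀ p ∈ n.primeFactors, z ≤ (p : ℝ) then 1 / V else 0) → Φ = (fun m : ℕ => if (x : ℝ) ^ (ε ^ 2) ≤ (m.minFac : ℝ) ∧ (m.minFac : ℝ) < (x : ℝ) ^ ((1 : ℝ) / 5) then ∑ d ∈ (Nat.divisors m).filter (fun d : ℕ => (d : ℝ) ≤ (x : ℝ) ^ ((1 : ℝ) /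 2 - 2 * ε) ∧ ∀ p ∈ d.primeFactors, (x : ℝ) ^ ((1 : ℝ) / 5) ≤ (p : ℝ)), (ArithmeticFunction.moebius d : ℝ) else 0) → c₀ * (x : ℝ) / Real.log (x : ℝ) ≤ ∑ n ∈ Finset.Ioc x (2 * x), b n * (ArithmeticFunction.liouville (n + 2) : ℝ) * Φ (n + 2) := by
  sorry

/-! ### The split (real proofs) -/

/-- `W_λ = Σ_{x<p≤2x} log p·λ(p+2) − Σ b_n λ(n+2)` — the prime part of `W_λ` is the Pintz sum. -/
theorem Wl_eq (x : ℕ) : Wl x = SP x - LR x := by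
  simp only [Wl, SP, LR]
  rw [Finset.sum_filter, ← Finset.sum_sub_distrib]
  refine Finset.sum_congr rfl ?_
  intro n _
  simp only [aR]
  split_ifs <;> ring

/-- **The three-line split, abstractly.** For real sequences `W, P` (indexed by `ε, x`) and
`B, W_λ, S, L` (indexed by `x`) with `W_λ = S − L`: K2 (`W − (P/B) W_λ ≤ θ x/log x` for every `θ > 0`,
eventually), K1 (`S ≤ κ x`, `κ < 1`), `B = (1 + o(1)) x`, `L = o(x)` and `P ≥ c₀(ε) x / log x` give
`W ≤ (1 − η) P` eventually, with `η = (1 − max κ 0)/3`. -/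
theorem assembly_abstract {W P : ℝ → ℕ → ℝ} {Bf Wlf Sf Lf : ℕ → ℝ}
    (hWl : ∀ x, Wlf x = Sf x - Lf x)
    (hB : ∀ δ : ℝ, 0 < δ → ∃ x₀ : ℕ, ∀ x : ℕ, x₀ ≤ x → |Bf x - (x : ℝ)| ≤ δ * (x : ℝ))
    (hL : ∀ δ : ℝ, 0 < δ → ∃ x₀ : ℕ, ∀ x : ℕ, x₀ ≤ x → |Lf x| ≤ δ * (x : ℝ))
    (hP : ∃ ε₁ : ℝ, 0 < ε₁ ∧ ∀ ε : ℝ, 0 < ε → ε ≤ ε₁ → ∃ c₀ : ℝ, 0 < c₀ ∧ ∃ x₀ : ℕ, ∀ x : ℕ, x₀ ≤ x →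
      c₀ * (x : ℝ) / Real.log (x : ℝ) ≤ P ε x)
    (hK2 : ∃ ε₁ : ℝ, 0 < ε₁ ∧ ∀ ε : ℝ, 0 < ε → ε ≤ ε₁ → ∀ θ : ℝ, 0 < θ → ∃ x₀ : ℕ, ∀ x : ℕ, x₀ ≤ x →
      W ε x - P ε x / Bf x * Wlf x ≤ θ * (x : ℝ) / Real.log (x : ℝ))
    (hK1 : ∃ κ : ℝ, κ < 1 ∧ ∃ x₀ : ℕ, ∀ x : ℕ, x₀ ≤ x → Sf x ≤ κ * (x : ℝ)) :
    ∃ η : ℝ, 0 < η ∧ ∃ ε₁ : ℝ, 0 < ε₁ ∧ ∀ ε : ℝ, 0 < ε → ε ≤ ε₁ → ∃ x₀ : ℕ, ∀ x : ℕ, x₀ ≤ x →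
      W ε x ≤ (1 - η) * P ε x := by
  obtain ⟨ε₁, hε₁, hK2⟩ := hK2
  obtain ⟨κ, hκ, xK, hK1⟩ := hK1
  obtain ⟨ε₂, hε₂, hP⟩ := hP
  -- the slack `s = 1 − κ₊ ∈ (0, 1]`, `κ₊ = max κ 0`
  obtain ⟨s, hs⟩ : ∃ s : ℝ, s = 1 - max κ 0 := ⟨_, rfl⟩
  have hs0 : 0 < s := by
    have : max κ 0 < 1 := max_lt hκ one_pos
    linarith
  have hs1 : s ≤ 1 := by
    have : (0 : ℝ) ≤ max κ 0 := le_max_right _ _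
    linarith
  refine ⟨s / 3, by positivity, min ε₁ ε₂, lt_min hε₁ hε₂, ?_⟩
  intro ε hε hεle
  obtain ⟨c₀, hc₀, xP, hPx⟩ := hP ε hε (hεle.trans (min_le_right _ _))
  obtain ⟨xW, hWx⟩ := hK2 ε hε (hεle.trans (min_le_left _ _)) (c₀ * s / 3) (by positivity)
  obtain ⟨xB, hBx⟩ := hB (s / 6) (by positivity)
  obtain ⟨xL, hLx⟩ := hL (s / 6) (by positivity)
  refine ⟨max (max (max xK xP) (max xW xB)) (max xL 2), ?_⟩
  intro x hx
  simp only [max_le_iff] at hx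
  obtain ⟨⟨⟨hxK, hxP⟩, hxW, hxB⟩, hxL, hx2⟩ := hx
  have hx1 : (1 : ℝ) < (x : ℝ) := by exact_mod_cast (lt_of_lt_of_le (by norm_num) hx2 : 1 < x)
  have hxpos : (0 : ℝ) < (x : ℝ) := by linarith
  have hlog : 0 < Real.log (x : ℝ) := Real.log_pos hx1
  have h1 := hWx x hxW
  have h2 := hPx x hxP
  have h3 := abs_le.mp (hBx x hxB)
  have h4 := abs_le.mp (hLx x hxL)
  have h5 := hK1 x hxK
  -- positivity of `Π` and of the model mass `B`
  have hquot : 0 < c₀ * (x : ℝ) / Real.log (x : ℝ) := div_pos (mul_pos hc₀ hxpos) hlog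
  have hPpos : 0 < P ε x := lt_of_lt_of_le hquot h2
  have hBlow : (1 - s / 6) * (x : ℝ) ≤ Bf x := by linarith [h3.1]
  have hBpos : 0 < Bf x := lt_of_lt_of_le (mul_pos (by linarith) hxpos) hBlow
  -- `W_λ = S − L ≤ (κ₊ + s/6) x = (1 − s + s/6) x`
  have hSf : Sf x ≤ (1 - s) * (x : ℝ) := by
    have hk : κ * (x : ℝ) ≤ max κ 0 * (x : ℝ) := mul_le_mul_of_nonneg_right (le_max_left _ _) hxpos.le
    have e : (1 - s) = max κ 0 := by rw [hs]; ring
    rw [e]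
    exact h5.trans hk
  have hWl' : Wlf x ≤ (1 - s + s / 6) * (x : ℝ) := by
    rw [hWl]
    linarith [h4.1]
  -- `t₁ = Π / B ≥ 0` and the middle term
  have ht : 0 ≤ P ε x / Bf x := div_nonneg hPpos.le hBpos.le
  have h6 : P ε x / Bf x * Wlf x ≤ P ε x / Bf x * ((1 - s + s / 6) * (x : ℝ)) :=
    mul_le_mul_of_nonneg_left hWl' ht
  have h7 : (1 - s + s / 6) * (x : ℝ) ≤ (1 - s + s / 3) * Bf x := by
    have h7a : (1 - s + s / 3) * ((1 - s / 6) * (x : ℝ)) ≤ (1 - s + s / 3) * Bf x :=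
      mul_le_mul_of_nonneg_left hBlow (by linarith)
    nlinarith [h7a, mul_nonneg (mul_nonneg hs0.le hs0.le) hxpos.le]
  have h8 : P ε x / Bf x * ((1 - s + s / 6) * (x : ℝ)) ≤ P ε x / Bf x * ((1 - s + s / 3) * Bf x) :=
    mul_le_mul_of_nonneg_left h7 ht
  have h9 : P ε x / Bf x * ((1 - s + s / 3) * Bf x) = (1 - s + s / 3) * P ε x := by
    have hBne : Bf x ≠ 0 := hBpos.ne'
    calc P ε x / Bf x * ((1 - s + s / 3) * Bf x) = (1 - s + s / 3) * (P ε x * (Bf x / Bf x)) := by ring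
      _ = (1 - s + s / 3) * P ε x := by rw [div_self hBne, mul_one]
  -- the `θ`-term
  have h10 : c₀ * s / 3 * (x : ℝ) / Real.log (x : ℝ) ≤ s / 3 * P ε x := by
    have h10a := mul_le_mul_of_nonneg_left h2 (by positivity : (0 : ℝ) ≤ s / 3)
    calc c₀ * s / 3 * (x : ℝ) / Real.log (x : ℝ) = s / 3 * (c₀ * (x : ℝ) / Real.log (x : ℝ)) := by ring
      _ ≤ s / 3 * P ε x := h10a
  have h11 : W ε x ≤ c₀ * s / 3 * (x : ℝ) / Real.log (x : ℝ) + P ε x / Bf x * Wlf x := by linarith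
  calc W ε x ≤ s / 3 * P ε x + (1 - s + s / 3) * P ε x := by linarith [h6, h8, h9, h10, h11]
    _ = (1 - s / 3) * P ε x := by ring

/-- The split over the named objects: stubs 1–3 and K2, K1 (in dictionary form) give X. -/
theorem plainSplit_explicit
    (hB : ∀ δ : ℝ, 0 < δ → ∃ x₀ : ℕ, ∀ x : ℕ, x₀ ≤ x → |BR x - (x : ℝ)| ≤ δ * (x : ℝ))
    (hL : ∀ δ : ℝ, 0 < δ → ∃ x₀ : ℕ, ∀ x : ℕ, x₀ ≤ x → |LR x| ≤ δ * (x : ℝ))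
    (hP : ∃ ε₁ : ℝ, 0 < ε₁ ∧ ∀ ε : ℝ, 0 < ε → ε ≤ ε₁ → ∃ c₀ : ℝ, 0 < c₀ ∧ ∃ x₀ : ℕ, ∀ x : ℕ, x₀ ≤ x →
      c₀ * (x : ℝ) / Real.log (x : ℝ) ≤ PiL ε x)
    (hK2 : ∃ ε₁ : ℝ, 0 < ε₁ ∧ ∀ ε : ℝ, 0 < ε → ε ≤ ε₁ → ∀ θ : ℝ, 0 < θ → ∃ x₀ : ℕ, ∀ x : ℕ, x₀ ≤ x →
      WΦ ε x - PiL ε x / BR x * Wl x ≤ θ * (x : ℝ) / Real.log (x : ℝ))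
    (hK1 : ∃ κ : ℝ, κ < 1 ∧ ∃ x₀ : ℕ, ∀ x : ℕ, x₀ ≤ x → SP x ≤ κ * (x : ℝ)) :
    ∃ η : ℝ, 0 < η ∧ ∃ ε₁ : ℝ, 0 < ε₁ ∧ ∀ ε : ℝ, 0 < ε → ε ≤ ε₁ → ∃ x₀ : ℕ, ∀ x : ℕ, x₀ ≤ x →
      WΦ ε x ≤ (1 - η) * PiL ε x :=
  assembly_abstract Wl_eq hB hL hP hK2 hK1

/-- **BC3 composition.** `stub_roughMass → stub_roughLiouville → stub_calibrationLowerBound → PlainSplit`: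
the hypotheses are the three registered stub signatures BY NAME (`Sig.stub_*`, definitionally the
statements of the `stub_*` theorems) and the conclusion is literally the route decl
`ParityLeakOneFifth.PlainSplit`; a complete proof (axioms `propext`, `Classical.choice`, `Quot.sound`). -/
theorem PlainSplit_of :
    Sig.stub_roughMass → Sig.stub_roughLiouville → Sig.stub_calibrationLowerBound →
      Summit.Parity.GeneralizedHardyLittlewood.Theses.ParityLeakOneFifth.PlainSplit := by
  intro hB hL hP hK2 hK1
  exact e1NonSaturation_iff.2
    (plainSplit_explicit (sig_roughMass_iff.1 hB) (sig_roughLiouville_iff.1 hL)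
      (sig_calibrationLowerBound_iff.1 hP) (calibratedE1_iff.1 hK2) (pintzDensity_iff.1 hK1))

/-- The skeleton instantiated: the crux BY NAME modulo the three registered stubs (carries their
`sorry`s, nothing else). -/
theorem plainSplit_of_stubs :
    Summit.Parity.GeneralizedHardyLittlewood.Theses.ParityLeakOneFifth.PlainSplit :=
  PlainSplit_of stub_roughMass stub_roughLiouville stub_calibrationLowerBound

end Summit.Parity.GeneralizedHardyLittlewood.Cruxes.PlainSplit.Birth
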